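import Mathlib
import Summits.NavierStokesRegularity.NavierStokesRegularity.Theorems.WakeRatchetTailTools
import Summits.NavierStokesRegularity.NavierStokesRegularity.Theses.WakeRatchet
import HarnessLib

/-!
# `WakeRatchet.RatchetStarvation` (item stmt-NavierStokesRegularity-21810) — the `a = 1`
  bookkeeping step of route `WakeRatchet`

**Statement (the route decl, verbatim).** For `ε₀ > 0`, `w > 0` with `(1+ε₀)(1−w) < 1`, an
admissible eternal solution `W` of a Tao-type renormalised MODEL lattice (`IsEternalVisc ε₀ ν̂ α W`,
`UniformBound W`) whose tail energies `Θ_n(σ) = Σ_{k ≥ 0} E_{n+k}(σ)` (`E = physEnergy`) are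
bounded in `σ` for every `n`, and whose tail envelopes contract by the factor `1 − w` per shell
(`(∀ σ, Θ_n(σ) ≤ M) → ∀ σ, Θ_{n+1}(σ) ≤ (1 − w) M`), is NOT forward `(S₁)`-surviving
(`¬ EternalSurvivingFwd 1 ε₀ W`).

PROOF (elementary real analysis, as on the item card). Let `Θ₀` bound the tail at shell `0` and
`r := max (1 − w) 0`. Induction on `j` gives `Σ_k E_{j+k}(σ) ≤ r^j Θ₀` for all `σ`
(`tail_le_pow`). Under `UniformBound` the tail series converges, so `E_j ≤ Σ_k E_{j+k}`
(`WakeRatchetTail.physEnergy_le_tail`, file `WakeRatchetTailTools.lean`). The `a = 1`-weighted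
energy is `p_j = (1+ε₀)^j E_j` (`wtEnergy_eq`), so `p_j(σ) ≤ q^j Θ₀` with
`q := (1+ε₀) r = max ((1+ε₀)(1−w)) 0 ∈ [0, 1)`; `q^j Θ₀ → 0`, whereas forward survival asks for a
fixed level `c > 0` of `p_n(σ)` at arbitrarily high shells — contradiction (`main`). The
hypotheses `0 < w` and `IsEternalVisc` of the item are not used by the argument.

HONEST FRAMING: bookkeeping about bounded eternal solutions of Tao-type MODEL lattice ODEs
(Tao 2016 §4, renormalised variables of §6.4); nothing here is a statement about the
Navier–Stokes equations, and the route's rung leaf (`TaoLadderRungTwoBreak.Target`, TL-M2Break)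
is not the summit Statement.
-/

noncomputable section

set_option linter.dupNamespace false

namespace Summit.NavierStokesRegularity.NavierStokesRegularity.Theorems

namespace RatchetStarvation

open Filter Topology
open Literature.Analysis.FluidPDE Literature.Analysis.FluidPDE.TaoCascade
open WakeRatchetTail

variable {m : ℕ} {ε₀ : ℝ} {W : ℤ → ℝ → Em m}

/-- The contraction induction: if the tail at shell `0` is bounded by `Θ₀` and every tail envelope
contracts by `1 − w` per shell, then `Σ_k E_{j+k}(σ) ≤ r^j Θ₀` with `r = max (1 − w) 0`.
[cite: Tao2016AveragedNS, §4 (statement shape only); elementary induction] -/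
theorem tail_le_pow {w Θ₀ : ℝ} (hΘ₀ : 0 ≤ Θ₀)
    (hΘ : ∀ σ : ℝ, ∑' k : ℕ, physEnergy ε₀ W ((0 : ℤ) + k) σ ≤ Θ₀)
    (hContr : ∀ (n : ℤ) (M : ℝ), (∀ σ : ℝ, ∑' k : ℕ, physEnergy ε₀ W (n + k) σ ≤ M) →
      ∀ σ : ℝ, ∑' k : ℕ, physEnergy ε₀ W (n + 1 + k) σ ≤ (1 - w) * M) :
    ∀ (j : ℕ) (σ : ℝ), ∑' k : ℕ, physEnergy ε₀ W ((j : ℤ) + k) σ ≤ max (1 - w) 0 ^ j * Θ₀ := by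
  intro j
  induction j with
  | zero =>
    intro σ
    simpa only [Nat.cast_zero, pow_zero, one_mul] using hΘ σ
  | succ j ih =>
    intro σ
    have h := hContr (j : ℤ) (max (1 - w) 0 ^ j * Θ₀) ih σ
    have hnn : 0 ≤ max (1 - w) 0 ^ j * Θ₀ := mul_nonneg (pow_nonneg (le_max_right _ _) _) hΘ₀
    push_cast
    calc ∑' k : ℕ, physEnergy ε₀ W ((j : ℤ) + 1 + k) σ
        ≤ (1 - w) * (max (1 - w) 0 ^ j * Θ₀) := h
      _ ≤ max (1 - w) 0 * (max (1 - w) 0 ^ j * Θ₀) :=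
          mul_le_mul_of_nonneg_right (le_max_left _ _) hnn
      _ = max (1 - w) 0 ^ (j + 1) * Θ₀ := by ring

/-- **The item's content.** Bounded tail envelopes contracting by `1 − w` per shell with
`(1+ε₀)(1−w) < 1` force the `a = 1`-weighted shell energies `p_n = (1+ε₀)^n E_n` to decay
geometrically in `n`, uniformly in `σ`, which is incompatible with forward `(S₁)`-survival.
[cite: Tao2016AveragedNS, §4 Thm. 4.2 (statement shape), Lemma 4.1 (4.8)–(4.10), §6.4; elementary] -/
theorem main {w : ℝ} (hε : 0 < ε₀) (hq : (1 + ε₀) * (1 - w) < 1) (hU : UniformBound W)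
    (hEnv : ∀ n : ℤ, ∃ M : ℝ, ∀ σ : ℝ, ∑' k : ℕ, physEnergy ε₀ W (n + k) σ ≤ M)
    (hContr : ∀ (n : ℤ) (M : ℝ), (∀ σ : ℝ, ∑' k : ℕ, physEnergy ε₀ W (n + k) σ ≤ M) →
      ∀ σ : ℝ, ∑' k : ℕ, physEnergy ε₀ W (n + 1 + k) σ ≤ (1 - w) * M) :
    ¬ EternalSurvivingFwd 1 ε₀ W := by
  obtain ⟨Θ₀, hΘ⟩ := hEnv 0
  have hΘ₀ : 0 ≤ Θ₀ :=
    (tsum_nonneg fun k : ℕ => physEnergy_nonneg ε₀ W ((0 : ℤ) + (k : ℤ)) 0).trans (hΘ 0)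
  set r : ℝ := max (1 - w) 0 with hr
  have hr0 : 0 ≤ r := le_max_right _ _
  set q : ℝ := (1 + ε₀) * r with hqdef
  have hq0 : 0 ≤ q := mul_nonneg (by linarith) hr0
  have hq1 : q < 1 := by
    rcases le_or_gt 0 (1 - w) with h | h
    · have : r = 1 - w := max_eq_left h
      rw [hqdef, this]
      exact hq
    · have : r = 0 := max_eq_right h.le
      rw [hqdef, this, mul_zero]
      exact one_pos
  -- the weighted energies decay geometrically, uniformly in `σ`
  have hwt : ∀ (n : ℕ) (σ : ℝ), wtEnergy ε₀ W n σ ≤ q ^ n * Θ₀ := by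
    intro n σ
    rw [wtEnergy_eq hε]
    have h1 : physEnergy ε₀ W n σ ≤ r ^ n * Θ₀ :=
      (physEnergy_le_tail hε hU n σ).trans (tail_le_pow hΘ₀ hΘ hContr n σ)
    have h2 : (0 : ℝ) ≤ (1 + ε₀) ^ n := pow_nonneg (by linarith) n
    calc (1 + ε₀) ^ n * physEnergy ε₀ W n σ ≤ (1 + ε₀) ^ n * (r ^ n * Θ₀) :=
          mul_le_mul_of_nonneg_left h1 h2
      _ = q ^ n * Θ₀ := by rw [hqdef, mul_pow]; ring
  -- survival would pin a fixed positive level at arbitrarily high shells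
  rintro ⟨c, hc, hsurv⟩
  have hlim : Tendsto (fun n : ℕ => q ^ n * Θ₀) atTop (𝓝 0) := by
    simpa only [zero_mul] using (tendsto_pow_atTop_nhds_zero_of_lt_one hq0 hq1).mul_const Θ₀
  obtain ⟨N, hN⟩ := eventually_atTop.1 (hlim.eventually (gt_mem_nhds hc))
  obtain ⟨n, hn, σ, -, hle⟩ := hsurv N
  have h1 : c ≤ wtEnergy ε₀ W n σ := hle
  have h2 : q ^ n * Θ₀ < c := hN n hn
  linarith [hwt n σ]

end RatchetStarvation

open RatchetStarvation in
/-- **Item stmt-NavierStokesRegularity-21810** (`WakeRatchet.RatchetStarvation`): finite tail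
envelopes plus the per-shell tail contraction at a `w` with `(1+ε₀)(1−w) < 1` exclude forward
`(S₁)`-survival of a uniformly bounded admissible eternal solution of a Tao-type MODEL lattice.
[cite: Tao2016AveragedNS, §4 Thm. 4.2 (statement shape), Lemma 4.1 (4.8)–(4.10), §6.4; elementary] -/
theorem wakeRatchet_ratchetStarvation_proof :
    Summit.NavierStokesRegularity.NavierStokesRegularity.Theses.WakeRatchet.RatchetStarvation := by
  unfold Summit.NavierStokesRegularity.NavierStokesRegularity.Theses.WakeRatchet.RatchetStarvation
  intro ε₀ w νh α W hε _hw hq _hW hU hEnv hContr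
  exact main hε hq hU hEnv hContr

end Summit.NavierStokesRegularity.NavierStokesRegularity.Theorems

end
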